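import Summits.RiemannHypothesis.RiemannHypothesis.Theorems.Splittings.LiDirichletSqrtLagLaw
import HarnessLib

/-!
# THE DIRICHLET SQUARE-ROOT LAG LAW (part 2/2): the GRH-free bounded-below converse for `L(s, χ)` and the relabelling

PRE-CUT (not filed): cell rh-split, seat rh-split-li-bridge g14 (brief sha16 f79c5f09d8bcb036), card
`run/shared/lean/pub/rh-split/cards/SPLIT-li-bridge.md` §21; kernel source `HOME/rh-split-li-bridge/SketchG14.lean`
sha16 725d0c5abc4b986a (486 l, 26 theorems, farm rc 0 · 0 err · 0 warn · 0 sorry, std axioms); cut by the seat into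
TWO files ≤ 400 l (this = part 2/2, SketchG14 §4), decl text byte-verbatim; deltas = namespace, this header,
`set_option linter.dupNamespace false`, `import`/`open` of part 1.  A typer files it only after the referee's label line (cell rule).
Zero definitions; tree inputs cited, not re-derived.

§4: `grh_of_liCoeffCharRe_bddBelow` — `χ` primitive mod `q > 1`, `Re λ_χ(n) ≥ −K` for all `n ≥ 1` ⟹ `GRH(χ)`
(Bombieri–Lagarias 1999 Thm 1 (c)⇒(a), tree `bombieriLagarias1999_theorem1_pos_of_bddBelow`, on the zero family with
B–L weight `LiDirichlet.summable_weight_zeros`, plus the symmetry `WeilConverseChar.one_sub_conj_mem`; the tree types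
only the `≥ 0` criterion `LiDirichlet.riemannHypothesis_iff_liCoeffCharRe_nonneg`); hence ONE anchored comparison
(`grh_of_liChar_anchor`), EVERY lag law (`grh_of_liChar_lagLaw`), «eventually non-decreasing»
(`grh_of_liChar_eventually_nondecreasing`) and the Omar–Ouni–Mazhouda conjecture (`grh_of_oom_conjecture`; LMS JCM 14
(2011) — RETRACTED 2017; arXiv:1507.03431 p. 6) each imply `GRH(χ)`; `grh_iff_liChar_sqrtLag` / `grh_iff_liChar_lagLaw`
(every lag `f ≥ 120√·`): `GRH(χ) ⟺` the lag law — RELABELLING, neither side asserted; `oom_implies_sqrtLag`.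

HONEST LABEL: SPLITTING SEARCH over kernel-typed RH-EQUIVALENCES; a splitting A ∧ B ⟹ RH is CONDITIONAL
bookkeeping unless A and B are both proved; nothing here bears on the truth of RH.  Every theorem below is a
GRH(χ)-FREE implication, an inequality conditional on a named verified-height / explicit-bound fact carried as a
hypothesis, a GRH(χ)-consequence (`χ.RiemannHypothesis → …`), or a GRH(χ)-equivalence labelled RELABELLING; none is
a claim about RH or GRH.
-/

set_option linter.dupNamespace false

namespace Summit.RiemannHypothesis.RiemannHypothesis.Theorems.Splittings.LiDirichletLiConverse

open scoped ComplexConjugate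
open Literature.NumberTheory.LFunctions Literature.NumberTheory.LFunctions.ExplicitPsiChar
open Literature.NumberTheory.LFunctions.BombieriLagarias
open Summit.RiemannHypothesis.RiemannHypothesis.Theorems.LiTheory

open Summit.RiemannHypothesis.RiemannHypothesis.Theorems.Splittings.LiDirichletSqrtLagLaw

/-! ## §4 The GRH-free converse for `L(s, χ)` and the relabelling -/

section Converse

variable {q : ℕ} [NeZero q] {χ : DirichletCharacter ℂ q}

/-- A non-trivial zero of `L(s, χ)` is `≠ 0` (its real part is positive). -/
theorem coe_charZero_ne_zero (ρ : charNontrivialZeros χ) : (ρ : ℂ) ≠ 0 := by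
  intro h
  have h' := ρ.2.2.1
  rw [h, Complex.zero_re] at h'
  exact lt_irrefl _ h'

/-- A non-trivial zero of `L(s, χ)` is `≠ 1` (its real part is `< 1`). -/
theorem coe_charZero_ne_one (ρ : charNontrivialZeros χ) : (ρ : ℂ) ≠ 1 := by
  intro h
  have h' := ρ.2.2.2
  rw [h, Complex.one_re] at h'
  exact lt_irrefl _ h'

/-- **GRH-FREE CONVERSE (Bombieri–Lagarias 1999 Thm 1, bounded-below form, for `L(s, χ)`; new in kernel for `χ` —
the tree types only the `≥ 0` criterion):** for `χ` primitive mod `q > 1`, if `Re λ_χ(n) ≥ −K` for all `n ≥ 1`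
then `GRH(χ)`.  (`bombieriLagarias1999_theorem1_pos_of_bddBelow` on the family of non-trivial zeros with their
multiplicities — B–L's hypothesis is `LiDirichlet.summable_weight_zeros` — gives `Re ρ ≥ 1/2`; the symmetry
`ρ ↦ 1 − ρ̄` (`WeilConverseChar.one_sub_conj_mem`) gives `Re ρ = 1/2`.) [cite: BombieriLagarias1999, Theorem 1;
Li2004, p. 494] -/
theorem grh_of_liCoeffCharRe_bddBelow (hχ : χ.IsPrimitive) (hq : 1 < q) {K : ℝ}
    (hK : ∀ n : ℕ, 1 ≤ n → -K ≤ LiDirichlet.liCoeffCharRe χ n) : χ.RiemannHypothesis := by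
  have hχ1 : χ ≠ 1 := ne_one_of_isPrimitive hχ hq
  have hBL := bombieriLagarias1999_theorem1_pos_of_bddBelow (fun ρ : charNontrivialZeros χ ↦ (ρ : ℂ))
    (fun ρ ↦ DirichletDisc.zeroOrder χ (ρ : ℂ)) (fun ρ ↦ one_le_zeroOrder_of_mem hχ1 ρ.2)
    (fun ρ ↦ coe_charZero_ne_zero ρ) (fun ρ ↦ coe_charZero_ne_one ρ) (LiDirichlet.summable_weight_zeros hχ hq)
    (K := K) (fun n hn ↦ by simpa [LiDirichlet.liCoeffCharRe] using hK n hn)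
  intro s hs h0 h1
  have hρ : s ∈ charNontrivialZeros χ := ⟨hs, h0, h1⟩
  have hge : 1 / 2 ≤ s.re := hBL ⟨s, hρ⟩
  have hle := hBL ⟨1 - conj s, WeilConverseChar.one_sub_conj_mem hχ hχ1 hρ⟩
  simp only [Complex.sub_re, Complex.one_re, Complex.conj_re] at hle
  linarith

/-- **GRH-FREE: one anchored comparison is already `GRH(χ)`.** If for SOME `m` and some real `B`, `λ_χ(m) ≤ λ_χ(n)`
for every `n ≥ B`, then `Re λ_χ` is bounded below, hence `GRH(χ)`. [cite: BombieriLagarias1999, Theorem 1] -/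
theorem grh_of_liChar_anchor (hχ : χ.IsPrimitive) (hq : 1 < q) {m : ℕ} {B : ℝ}
    (h : ∀ n : ℕ, B ≤ (n : ℝ) → LiDirichlet.liCoeffCharRe χ m ≤ LiDirichlet.liCoeffCharRe χ n) :
    χ.RiemannHypothesis := by
  obtain ⟨T, hT⟩ := exists_nat_ge B
  set H : ℝ := ∑ k ∈ Finset.range T, |LiDirichlet.liCoeffCharRe χ k| with hH
  have hH0 : 0 ≤ H := Finset.sum_nonneg fun k _ ↦ abs_nonneg _
  refine grh_of_liCoeffCharRe_bddBelow hχ hq (K := H + |LiDirichlet.liCoeffCharRe χ m|) fun n _ ↦ ?_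
  by_cases hnT : n < T
  · have hle : |LiDirichlet.liCoeffCharRe χ n| ≤ H :=
      Finset.single_le_sum (f := fun k ↦ |LiDirichlet.liCoeffCharRe χ k|) (fun k _ ↦ abs_nonneg _)
        (Finset.mem_range.2 hnT)
    have := neg_abs_le (LiDirichlet.liCoeffCharRe χ n)
    linarith [abs_nonneg (LiDirichlet.liCoeffCharRe χ m)]
  · have hTn : (T : ℝ) ≤ n := by exact_mod_cast not_lt.1 hnT
    have := h n (hT.trans hTn)
    linarith [neg_abs_le (LiDirichlet.liCoeffCharRe χ m)]

/-- **GRH-FREE: EVERY lag law for `λ_χ` implies `GRH(χ)`** (anchor at `m₀`). -/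
theorem grh_of_liChar_lagLaw (hχ : χ.IsPrimitive) (hq : 1 < q) {f : ℕ → ℝ} {m₀ : ℕ}
    (h : ∀ m : ℕ, m₀ ≤ m → ∀ n : ℕ, (m : ℝ) + f m ≤ n →
      LiDirichlet.liCoeffCharRe χ m ≤ LiDirichlet.liCoeffCharRe χ n) :
    χ.RiemannHypothesis :=
  grh_of_liChar_anchor hχ hq (m := m₀) (B := (m₀ : ℝ) + f m₀) fun n hn ↦ h m₀ le_rfl n hn

/-- **THE OMAR–OUNI–MAZHOUDA CONJECTURE ⟹ GRH(χ), in kernel (GRH-FREE implication; their p. 2: «should this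
conjecture hold, the validity of the Riemann hypothesis would follow»).**  Already the weakest reading — `Re λ_χ(n)`
EVENTUALLY NON-DECREASING — bounds the sequence below, hence `GRH(χ)` by Bombieri–Lagarias; «positive» is not used.
[cite: OmarOuniMazhouda2011, arXiv:1507.03431 Conjecture p. 6 and p. 2; BombieriLagarias1999, Theorem 1] -/
theorem grh_of_liChar_eventually_nondecreasing (hχ : χ.IsPrimitive) (hq : 1 < q) {n₀ : ℕ}
    (h : ∀ n : ℕ, n₀ ≤ n → LiDirichlet.liCoeffCharRe χ n ≤ LiDirichlet.liCoeffCharRe χ (n + 1)) :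
    χ.RiemannHypothesis := by
  have hmono : ∀ n : ℕ, n₀ ≤ n → LiDirichlet.liCoeffCharRe χ n₀ ≤ LiDirichlet.liCoeffCharRe χ n := by
    intro n hn
    induction n, hn using Nat.le_induction with
    | base => exact le_rfl
    | succ k hk ih => exact ih.trans (h k hk)
  exact grh_of_liChar_anchor hχ hq (m := n₀) (B := n₀) fun n hn ↦ hmono n (by exact_mod_cast hn)

/-- **The conjecture as printed («`λ_χ(n)` positive and increasing», all `n ≥ 1`) ⟹ GRH(χ)** — each conjunct
separately suffices: positivity via Li's criterion (`LiDirichlet.riemannHypothesis_iff_liCoeffCharRe_nonneg`),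
monotonicity via `grh_of_liChar_eventually_nondecreasing`. [cite: OmarOuniMazhouda2011, arXiv:1507.03431
Conjecture p. 6; Li2004, Theorem 2] -/
theorem grh_of_oom_conjecture (hχ : χ.IsPrimitive) (hq : 1 < q)
    (h : ∀ n : ℕ, 1 ≤ n → 0 < LiDirichlet.liCoeffCharRe χ n ∧
      LiDirichlet.liCoeffCharRe χ n < LiDirichlet.liCoeffCharRe χ (n + 1)) :
    χ.RiemannHypothesis :=
  grh_of_liChar_eventually_nondecreasing hχ hq (n₀ := 1) fun n hn ↦ ((h n hn).2).le

/-- The positivity conjunct alone ⟹ GRH(χ) (Li's criterion, tree). [cite: Li2004, Theorem 2] -/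
theorem grh_of_oom_positivity (hχ : χ.IsPrimitive) (hq : 1 < q)
    (h : ∀ n : ℕ, 1 ≤ n → 0 < LiDirichlet.liCoeffCharRe χ n) : χ.RiemannHypothesis :=
  (LiDirichlet.riemannHypothesis_iff_liCoeffCharRe_nonneg hχ hq).2 fun n hn ↦ (h n hn).le

/-- **GRH-EQUIVALENCE (RELABELLING; neither side asserted): `GRH(χ) ⟺` the Dirichlet square-root lag law.** -/
theorem grh_iff_liChar_sqrtLag (hχ : χ.IsPrimitive) (hq : 1 < q) :
    χ.RiemannHypothesis ↔
      ∃ m₀ : ℕ, ∀ m : ℕ, m₀ ≤ m → ∀ n : ℕ, (m : ℝ) + 120 * Real.sqrt m ≤ n →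
        LiDirichlet.liCoeffCharRe χ m < LiDirichlet.liCoeffCharRe χ n :=
  ⟨fun h ↦ ⟨10000, fun _ hm _ hn ↦ liChar_sqrtLag_monotone_of_grh hχ hq h hm hn⟩,
    fun ⟨_, h⟩ ↦ grh_of_liChar_lagLaw hχ hq (f := fun m ↦ 120 * Real.sqrt m) fun m hm n hn ↦ (h m hm n hn).le⟩

/-- **GRH-EQUIVALENCE for EVERY lag function `f ≥ 120√·` (RELABELLING):** dilations, windows, `c√m` (`c ≥ 120`) —
each such monotonicity statement for `λ_χ` is `GRH(χ)` restated; the OOM conjecture (lag `1`) is the `⟹ GRH(χ)` half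
with the converse open (RH-PLUS for `χ`). -/
theorem grh_iff_liChar_lagLaw (hχ : χ.IsPrimitive) (hq : 1 < q) {f : ℕ → ℝ}
    (hf : ∀ m : ℕ, 120 * Real.sqrt m ≤ f m) :
    χ.RiemannHypothesis ↔
      ∃ m₀ : ℕ, ∀ m : ℕ, m₀ ≤ m → ∀ n : ℕ, (m : ℝ) + f m ≤ n →
        LiDirichlet.liCoeffCharRe χ m < LiDirichlet.liCoeffCharRe χ n :=
  ⟨fun h ↦ ⟨10000, fun m hm n hn ↦ liChar_sqrtLag_monotone_of_grh hχ hq h hm (by linarith [hf m])⟩,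
    fun ⟨_, h⟩ ↦ grh_of_liChar_lagLaw hχ hq (f := f) fun m hm n hn ↦ (h m hm n hn).le⟩

/-- **EVENTUAL MONOTONICITY OF `λ_χ` SITS BETWEEN `GRH(χ)` AND THE LAG LAW (bookkeeping):** OOM's conjecture implies
`GRH(χ)`, which is equivalent to the `120√m` lag law; the gap «lag `1` vs lag `120√m`» is exactly where the census's
K7 lives (no implication `GRH(χ) ⟹ OOM` is claimed or known). -/
theorem oom_implies_sqrtLag (hχ : χ.IsPrimitive) (hq : 1 < q) {n₀ : ℕ}
    (h : ∀ n : ℕ, n₀ ≤ n → LiDirichlet.liCoeffCharRe χ n ≤ LiDirichlet.liCoeffCharRe χ (n + 1)) :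
    ∀ m : ℕ, 10000 ≤ m → ∀ n : ℕ, (m : ℝ) + 120 * Real.sqrt m ≤ n →
      LiDirichlet.liCoeffCharRe χ m < LiDirichlet.liCoeffCharRe χ n :=
  fun _ hm _ hn ↦ liChar_sqrtLag_monotone_of_grh hχ hq (grh_of_liChar_eventually_nondecreasing hχ hq h) hm hn

end Converse

end Summit.RiemannHypothesis.RiemannHypothesis.Theorems.Splittings.LiDirichletLiConverse
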